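import Summits.RiemannHypothesis.RiemannHypothesis.Theorems.SuzukiWindowsDoorWindowDilation

/-!
# SuzukiWindowsDoorOnsetTwoSharp — a sharp lower bound for the onset operator `A₂`: `‖A₂‖² ≥ 104/81` (`‖A₂‖ ≥ 1.1331`; certified `1.1377`) (column DBR; RH-FREE)

RH-FREE, `ζ`-FREE: an explicit Rayleigh-type bound for ONE polynomial-kernel operator, the onset operator `A₂` of the
small-window law (kernel `(u+v)₊` on `L²(−1,1)`; DATA §ET1f-lite certified `‖A₂‖ = 1.13765`).  With the test function
`f(v) = (1+v)²` (instead of `𝟙` in `SuzukiWindowsDoorWindowDilation.sq_opNorm_onsetOp_ge`, which gives `0.894`):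
`‖A₂f‖²/‖f‖² = (3328/405)/(32/5) = 104/81`, i.e. **`‖A₂‖ ≥ √104/9 = 1.1331`** — within `0.4 %` of the certified value.  Used by
`SuzukiWindowsDoorMuOneBound` to sharpen the cross-column bound on Suzuki's `μ₁`.  Stated for realisations with the kernel
written `(u+v)₊^{(2:ℝ)−1}` (the `θ = 2` member of the real family of `SuzukiWindowsDoorSmallWindowLawReal`).
Nothing here bears on the truth of RH.
-/

noncomputable section

-- D-0017: `Summit.<S>.<S>.…` is the designed namespace of a single-problem summit.
set_option linter.dupNamespace false

open MeasureTheory Set Filter Topology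

namespace Summit.RiemannHypothesis.RiemannHypothesis.Theorems.SuzukiWindowsDoorOnsetTwoSharp

open Literature.Analysis.OperatorTheory
open Summit.RiemannHypothesis.RiemannHypothesis.Theorems.SuzukiWindowsDoorWindowDilation

/-- The rows against the test function `(1+v)²`: for `|u| ≤ 1`, with `a = 1 − u`,
`∫_{(−1,1)} (u+v)₊ (1+v)² dv = 4 − 8a/3 + a⁴/12`. -/
theorem integral_onsetTwo_row {u : ℝ} (hu : u ∈ Icc (-1 : ℝ) 1) :
    ∫ v in Ioo (-1 : ℝ) 1, (max (u + v) 0) ^ ((2 : ℝ) - 1) * (1 + v) ^ 2 =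
      4 - 8 * (1 - u) / 3 + (1 - u) ^ 4 / 12 := by
  set a : ℝ := 1 - u with ha
  have ha0 : 0 ≤ a := by rw [ha]; linarith [hu.2]
  have ha2 : a ≤ 2 := by rw [ha]; linarith [hu.1]
  have hcont : Continuous fun w : ℝ => max (w - a) 0 * w ^ 2 := by fun_prop
  have hfun : (fun v : ℝ => (max (u + v) 0) ^ ((2 : ℝ) - 1) * (1 + v) ^ 2) =
      fun v : ℝ => max ((v + 1) - a) 0 * (v + 1) ^ 2 := by
    funext v
    rw [show (2 : ℝ) - 1 = 1 by norm_num, Real.rpow_one, ha]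
    ring_nf
  rw [setIntegral_Ioo_eq_intervalIntegral (by norm_num), hfun,
    intervalIntegral.integral_comp_add_right (fun w => max (w - a) 0 * w ^ 2) (1 : ℝ),
    show (-1 : ℝ) + 1 = 0 by norm_num, show (1 : ℝ) + 1 = 2 by norm_num,
    ← intervalIntegral.integral_add_adjacent_intervals (b := a) (hcont.intervalIntegrable _ _)
      (hcont.intervalIntegrable _ _)]
  have h1 : ∫ w in (0 : ℝ)..a, max (w - a) 0 * w ^ 2 = 0 := by
    have h : ∫ w in (0 : ℝ)..a, max (w - a) 0 * w ^ 2 = ∫ _ in (0 : ℝ)..a, (0 : ℝ) := by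
      refine intervalIntegral.integral_congr fun w hw => ?_
      rw [uIcc_of_le ha0] at hw
      simp only [max_eq_right (by linarith [hw.2] : w - a ≤ 0), zero_mul]
    rw [h, intervalIntegral.integral_zero]
  have h2 : ∫ w in a..(2 : ℝ), max (w - a) 0 * w ^ 2 = 4 - 8 * a / 3 + a ^ 4 / 12 := by
    have h : ∫ w in a..(2 : ℝ), max (w - a) 0 * w ^ 2 = ∫ w in a..(2 : ℝ), (w ^ 3 - a * w ^ 2) := by
      refine intervalIntegral.integral_congr fun w hw => ?_
      rw [uIcc_of_le ha2] at hw
      simp only [max_eq_left (by linarith [hw.1] : 0 ≤ w - a)]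
      ring
    rw [h, intervalIntegral.integral_sub (Continuous.intervalIntegrable (by fun_prop) _ _)
        (Continuous.intervalIntegrable (by fun_prop) _ _), intervalIntegral.integral_const_mul,
      integral_pow, integral_pow]
    norm_num
    ring
  rw [h1, h2, zero_add]

/-- **RH-FREE · `‖A₂‖² ≥ 104/81`** (`‖A₂‖ ≥ 1.1331`; certified `1.13765`, DATA §ET1f-lite): any bounded realisation `B` of
the onset operator with kernel `(u+v)₊^{2−1}` on `L²(−1,1)` — test function `(1+v)²`. -/
theorem sq_opNorm_onsetTwo_ge
    {B : Lp ℝ 2 (volume.restrict (Ioo (-1 : ℝ) 1)) →L[ℝ] Lp ℝ 2 (volume.restrict (Ioo (-1 : ℝ) 1))}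
    (hB : ∀ φ, (B φ : ℝ → ℝ) =ᵐ[volume.restrict (Ioo (-1 : ℝ) 1)]
      fun u => ∫ v in Ioo (-1 : ℝ) 1, (max (u + v) 0) ^ ((2 : ℝ) - 1) * φ v) :
    (104 : ℝ) / 81 ≤ ‖B‖ ^ 2 := by
  have hf : MemLp (fun v : ℝ => (1 + v) ^ 2) 2 (volume.restrict (Ioo (-1 : ℝ) 1)) := by
    refine MemLp.of_bound (by fun_prop : Continuous fun v : ℝ => (1 + v) ^ 2).aestronglyMeasurable 4 ?_
    filter_upwards [ae_restrict_mem measurableSet_Ioo] with v hv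
    rw [Real.norm_eq_abs, abs_of_nonneg (by positivity)]
    nlinarith [hv.1, hv.2]
  have h := sq_integral_winOp_le (K := fun w => (max w 0) ^ ((2 : ℝ) - 1)) hB hf
  have hrow : ∀ u ∈ Ioo (-1 : ℝ) 1, (∫ v in Ioo (-1 : ℝ) 1, (max (u + v) 0) ^ ((2 : ℝ) - 1) * (1 + v) ^ 2) =
      4 - 8 * (1 - u) / 3 + (1 - u) ^ 4 / 12 := fun u hu => integral_onsetTwo_row (Ioo_subset_Icc_self hu)
  have hL : ∫ u in Ioo (-1 : ℝ) 1, (∫ v in Ioo (-1 : ℝ) 1, (max (u + v) 0) ^ ((2 : ℝ) - 1) * (1 + v) ^ 2) ^ 2 =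
      3328 / 405 := by
    rw [setIntegral_congr_fun measurableSet_Ioo fun u hu => by rw [hrow u hu],
      setIntegral_Ioo_eq_intervalIntegral (by norm_num),
      intervalIntegral.integral_comp_sub_left (fun a : ℝ => (4 - 8 * a / 3 + a ^ 4 / 12) ^ 2) (1 : ℝ)]
    norm_num
    have hf2 : (fun a : ℝ => (4 - 8 * a / 3 + a ^ 4 / 12) ^ 2) = fun a : ℝ =>
        16 - 64 / 3 * a + 64 / 9 * a ^ 2 + 2 / 3 * a ^ 4 - 4 / 9 * a ^ 5 + 1 / 144 * a ^ 8 := by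
      funext a; ring
    rw [hf2]
    rw [intervalIntegral.integral_add, intervalIntegral.integral_sub, intervalIntegral.integral_add,
      intervalIntegral.integral_add, intervalIntegral.integral_sub]
    · simp only [intervalIntegral.integral_const_mul, integral_pow, intervalIntegral.integral_const, smul_eq_mul]
      have hid : ∫ x in (0 : ℝ)..2, 64 / 3 * x = 64 / 3 * ((2 : ℝ) ^ 2 - 0 ^ 2) / 2 := by
        rw [show (fun x : ℝ => 64 / 3 * x) = fun x : ℝ => 64 / 3 * x ^ 1 by funext x; ring,
          intervalIntegral.integral_const_mul, integral_pow]
        norm_num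
      rw [hid]
      norm_num
    all_goals exact (Continuous.intervalIntegrable (by fun_prop) _ _)
  have hR : ∫ u in Ioo (-1 : ℝ) 1, ((1 + u) ^ 2) ^ 2 = 32 / 5 := by
    rw [setIntegral_Ioo_eq_intervalIntegral (by norm_num)]
    have hf4 : (fun u : ℝ => ((1 + u) ^ 2) ^ 2) = fun u : ℝ => (u + 1) ^ 4 := by funext u; ring
    rw [hf4, intervalIntegral.integral_comp_add_right (fun w : ℝ => w ^ 4) (1 : ℝ), integral_pow]
    norm_num
  rw [hL, hR] at h
  linarith

end Summit.RiemannHypothesis.RiemannHypothesis.Theorems.SuzukiWindowsDoorOnsetTwoSharp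

end
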